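import Summits.ResolutionOfSingularities.ResolutionOfSingularities.Theorems.EquisingularLiftEquisingularLiftNatDirStepUnobsOfCharts
import Summits.ResolutionOfSingularities.ResolutionOfSingularities.Theorems.EquisingularLiftEquisingularLiftNatSpecimenWhitneyCubicCiNose
import Literature.AlgebraicGeometry.Resolution.ProjHomogeneousIdealSheaf
import Literature.AlgebraicGeometry.Motives.VarietiesProjectiveSpaceProofs
import Literature.AlgebraicGeometry.Resolution.QuasiRegularSequences
import Literature.AlgebraicGeometry.Resolution.RegularCentreLocal
import Literature.AlgebraicGeometry.Resolution.MvPolynomialKillVars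
import HarnessLib

/-!
# [OURS · L1 W4.5(b) · EL♮(3) · nose residue, brick N-1 (b), part 1/2] The twisted two-chart splitting in `(K[x]_{x₀x₁})₀` modulo `(x₂, x₃)`
# (`H¹(ℙ¹, 𝒪(1)) = 0` by hand) — the algebra behind `DirStepUnobs ℙ³ univ _ V(x₂, x₃)`

Cell `res-hironaka`, LADDER-RESOLUTION rung L (D-0089), slot W4.5(b), crux chain w45b: child crux **EL♮(3)** =
stmt-ResolutionOfSingularities-20148, parent EL♮ = stmt-…-20038; registered nose residue
`stub_elnat_three_nonisolated_nonUnobsNonPointsFirstNoseBTriplePrime` (38th registration), hypothesis `¬ NoseHypUnobsBTriplePrime` ((H-ν1), 37th).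
WIDTH seat res-L1-w45b-nose-w1 g2 (D-0157 DOOR 1), desk booking **N-1** «Whitney cubic ∈ ν1» (STATUS 2026-08-28T18:04:04Z), piece (b) of three
((a) ✓ `…NatNoseHypUnobsOfOneBlowup`, (c) the assembly `…NatSpecimenWhitneyCubicNu1`). `--supports stmt-ResolutionOfSingularities-20148 --as helper`.
OURS; NOT a statement of H. Hironaka's 2017 manuscript (nothing of [Hironaka2017] is asserted); AI-written, AI review weaker than expert review.
DEFINITION-FREE (local `notation3` abbreviations only); no `sorry`; standard axioms. EL♮(3) is NOT proved here; resolution in positive characteristic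
is NOT proved here (dimension 3 is Cossart–Piltant 2008/2009 in print).

THIS PART (1/2): the ring-level lemmas up to ★ `P3Line.exists_split`; part 2/2 (`…NatProjectiveSpaceLineDirStepUnobs`) moves them to sections and
assembles the `DirStepUnobs` instance. OVERALL: `P3Line.dirStepUnobs_doubleLine (K) [Field K] : DirStepUnobs ℙ³_K Set.univ isClosed_univ Σ _` for the coordinate line `Σ = V₊(x₂, x₃)` (the
double line of res-D-pv-022's Whitney-type cubic and of every cubic of res-L1-w45b-nose-w3's census), i.e. `Ȟ¹(Σ̃, 𝒩_{Σ̃/ℙ³}) = 0` in the tree's Čech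
currency — obtained from ✓ p655133 `dirStepUnobs_univ_of_two_charts` (res-L1-w45b-nose-w1, D3-7) with the data:
charts `D₊(x₀)`, `D₊(x₁)` (`ProjSubscheme.affineBasicOpen`; `D₊(x₀) ∩ D₊(x₁) = D₊(x₀x₁)` affine; they cover `Σ` because a relevant prime containing
`x₂, x₃` cannot contain `x₀` and `x₁`, `ProjectiveSpace.irrelevant_le_span`); generators `(x₂/xᵢ, x₃/xᵢ)` read through Mathlib's
`Proj.awayToSection : (K[x]_{xᵢ})₀ ≅ Γ(ℙ³, D₊(xᵢ))`, QUASI-REGULAR by transport (`IsQuasiRegular.map_ringEquiv`) of the regular sequence `(y₁, y₂)` of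
`K[y₀, y₁, y₂]` (`isWeaklyRegular_map_X`, `isQuasiRegular_of_isWeaklyRegular`) along `ProjectiveSpace.chartAlgEquiv`; THE IDEAL `𝓘⟨Σ⟩.ideal D₊(xᵢ) =
(x₂/xᵢ, x₃/xᵢ)`: `𝓘⟨Σ⟩ = ker Proj(f_K)` for the kill map `f_K : K[x₀..x₃] → K[x₀, x₁]` (nose-w3 ✓ `ker_projMap_kill_eq_vanishingIdeal_doubleLine`), whose
sections over `D₊(s)` are `(ker f_K)_{(s)}` (Literature ✓ `ker_projMap_ideal_basicOpen`, `awayIdeal_span_eq`; `ker f_K = (x₂, x₃)` by `LinearCentre.ker_kill`);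
TRANSITION MATRIX `M = (x₁/x₀)·1` (`x_{k}/x₀ = (x₁/x₀)(x_{k}/x₁)`, `res₀_chartGen_succ`); and ★ THE TWISTED SPLITTING `exists_split`: every degree-zero fraction
`z ∈ (K[x]_{x₀x₁})₀` is `a| + (x₁/x₀)·b|` MODULO `(ker f_K)_{(x₀x₁)}` with `a ∈ (K[x]_{x₀})₀`, `b ∈ (K[x]_{x₁})₀` — monomial by monomial
(`awayMk_eq_sum_monomial`): a monomial involving `x₂` or `x₃` is in the ideal (`kill_monomial_eq_zero`), and `x₀ⁱx₁ʲ/(x₀x₁)ᵐ` (`i + j = 2m`) is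
`(x₁/x₀)^{j−m}` from `D₊(x₀)` if `j ≥ m` (`monFrac_eq_res₀`) and `(x₁/x₀)·(x₀/x₁)^{i−m+1}` from `D₊(x₁)` if `j < m` (`monFrac_eq_tEl_mul_res₁`) — this is
`H¹(ℙ¹, 𝒪(1)) = 0` computed by hand; `hsplit_basicOpen` moves it to sections over `D₊(x₀x₁)` (`Proj.awayMap_awayToSection`, `Proj.basicOpenIsoAway`) and
`transport_of_eq` to the syntactic overlap `D₊(x₀) ⊓ D₊(x₁)` (`Proj.basicOpen_mul`).

References (method / index only): R. Hartshorne, *Algebraic Geometry* (1977), II Prop. 2.5, II Prop. 5.11 (proof), III Thm. 5.1 (Čech cohomology of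
`𝒪(n)` on the standard cover) [cite: Hartshorne1977]; The Stacks Project, Tag 01ED [cite: StacksProject].
-/

set_option linter.dupNamespace false -- mandated namespace `Summit.<Summit>.<Problem>` of this single-conjunct summit

noncomputable section

-- `TopCat.Presheaf`/`Scheme.Modules` are not reducible (as in Mathlib's `AlgebraicGeometry/Modules`).
set_option backward.isDefEq.respectTransparency false

open CategoryTheory CategoryTheory.Limits AlgebraicGeometry TopologicalSpace Opposite
open MvPolynomial HomogeneousLocalization
open Literature.AlgebraicGeometry.Resolution
open Literature.AlgebraicGeometry.Motives

namespace Summit.ResolutionOfSingularities.ResolutionOfSingularities.Cruxes.EquisingularLiftNat.Sections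

namespace P3Line

variable (K : Type) [Field K]

attribute [local instance] MvPolynomial.gradedAlgebra ProjBaseChange.algebraBase

local notation "𝒜" => MvPolynomial.homogeneousSubmodule (Fin (1 + 2 + 1)) K
local notation "A4" => MvPolynomial (Fin (1 + 2 + 1)) K

/-! ## §1 Algebra in the degree-zero localisations `(K[x]_{x₀})₀`, `(K[x]_{x₁})₀`, `(K[x]_{x₀x₁})₀` -/

/-- `x₀x₁` is homogeneous of degree `2`. -/
theorem X01_mem : (X 0 * X 1 : A4) ∈ 𝒜 2 :=
  SetLike.mul_mem_graded (ProjectiveSpace.X_mem (R := K) 0) (ProjectiveSpace.X_mem (R := K) 1)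

/-- `x₁²` is homogeneous of degree `1 • 2`. -/
theorem X_one_sq_mem : (X 1 ^ 2 : A4) ∈ 𝒜 (1 • 2) := by
  simpa using (isHomogeneous_X K (1 : Fin (1 + 2 + 1))).pow 2

/-! Local abbreviations (notation only; the file stays definition-free): the restrictions `res₀ : (K[x]_{x₀})₀ → (K[x]_{x₀x₁})₀`,
`res₁ : (K[x]_{x₁})₀ → (K[x]_{x₀x₁})₀` (Mathlib `HomogeneousLocalization.awayMap`), the transition function `tEl = x₁/x₀ = x₁²/(x₀x₁)`,
Mathlib's section isomorphism `aTS[s] : (K[x]_s)₀ → Γ(ℙ³, D₊(s))` (`Proj.awayToSection`), the affine charts `U[i] = D₊(xᵢ)`, the chart sections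
`gens[i] = (x_{i⁺1}/xᵢ, x_{i⁺2}/xᵢ)` (`i⁺ = i.succAbove`; for `i = 0, 1` these are `(x₂/xᵢ, x₃/xᵢ)`), and `kerKill[f]` the kernel of a graded map. -/
local notation3 "res₀" => HomogeneousLocalization.awayMap (MvPolynomial.homogeneousSubmodule (Fin (1 + 2 + 1)) K) (ProjectiveSpace.X_mem (R := K) (1 : Fin (1 + 2 + 1)))
  (rfl : (X 0 * X 1 : MvPolynomial (Fin (1 + 2 + 1)) K) = X 0 * X 1)
local notation3 "res₁" => HomogeneousLocalization.awayMap (MvPolynomial.homogeneousSubmodule (Fin (1 + 2 + 1)) K) (ProjectiveSpace.X_mem (R := K) (0 : Fin (1 + 2 + 1)))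
  (mul_comm (X 0 : MvPolynomial (Fin (1 + 2 + 1)) K) (X 1))
local notation3 "tEl" => HomogeneousLocalization.Away.mk (MvPolynomial.homogeneousSubmodule (Fin (1 + 2 + 1)) K) (X01_mem K) 1 (X 1 ^ 2 : MvPolynomial (Fin (1 + 2 + 1)) K) (X_one_sq_mem K)
local notation3 "aTS[" s "]" => CommRingCat.Hom.hom (Proj.awayToSection (MvPolynomial.homogeneousSubmodule (Fin (1 + 2 + 1)) K) s)
local notation3 "U[" i "]" => ProjSubscheme.affineBasicOpen (MvPolynomial.homogeneousSubmodule (Fin (1 + 2 + 1)) K) (X i : MvPolynomial (Fin (1 + 2 + 1)) K)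
  (ProjectiveSpace.X_mem (R := K) i) one_pos
local notation3 "gens[" i "]" => fun k : Fin 2 =>
  CommRingCat.Hom.hom (Proj.awayToSection (MvPolynomial.homogeneousSubmodule (Fin (1 + 2 + 1)) K) (X i : MvPolynomial (Fin (1 + 2 + 1)) K)) (ProjectiveSpace.chartGen K i k.succ)
local notation3 "kerKill[" f "]" => RingHom.ker (R := MvPolynomial (Fin (1 + 2 + 1)) K) (S := MvPolynomial (Fin (1 + 1)) K) f

/-- A homogeneous polynomial's monomials are homogeneous of the same degree. -/
theorem monomial_coeff_mem {N : ℕ} {p : A4} (hp : p ∈ 𝒜 N) (α : Fin (1 + 2 + 1) →₀ ℕ) (hα : α ∈ p.support) :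
    monomial α (coeff α p) ∈ 𝒜 N := by
  rw [mem_homogeneousSubmodule] at hp ⊢
  refine isHomogeneous_monomial _ ?_
  rw [Finsupp.degree_eq_weight_one]
  exact hp (mem_support_iff.mp hα)

/-- **Decomposition of a degree-zero fraction into monomial fractions** (same denominator). -/
theorem awayMk_eq_sum_monomial {s : A4} {d : ℕ} (hs : s ∈ 𝒜 d) (m : ℕ) (p : A4) (hp : p ∈ 𝒜 (m • d)) :
    HomogeneousLocalization.Away.mk 𝒜 hs m p hp =
      ∑ α ∈ p.support.attach, HomogeneousLocalization.Away.mk 𝒜 hs m (monomial α.1 (coeff α.1 p)) (monomial_coeff_mem K hp α.1 α.2) := by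
  apply HomogeneousLocalization.val_injective
  rw [← HomogeneousLocalization.algebraMap_apply, ← HomogeneousLocalization.algebraMap_apply, map_sum]
  simp only [HomogeneousLocalization.algebraMap_apply, HomogeneousLocalization.Away.val_mk]
  rw [← Localization.mk_sum]
  congr 1
  conv_lhs => rw [p.as_sum]
  exact (Finset.sum_attach p.support (fun α => monomial α (coeff α p))).symm

/-- `C c · x₁ⁿ` is homogeneous of degree `n`. -/
theorem C_mul_X_pow_mem (c : K) (i : Fin (1 + 2 + 1)) (n : ℕ) : (C c * X i ^ n : A4) ∈ 𝒜 (n • 1) := by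
  simpa using isHomogeneous_C_mul_X_pow c i n

/-- `C c · x₀ⁱ x₁ʲ` is homogeneous of degree `i + j`. -/
theorem C_mul_X_pow_mul_X_pow_mem (c : K) (i j m : ℕ) (hij : i + j = 2 * m) :
    (C c * X 0 ^ i * X 1 ^ j : A4) ∈ 𝒜 (m • 2) := by
  have h := (isHomogeneous_C_mul_X_pow c (0 : Fin (1 + 2 + 1)) i).mul ((isHomogeneous_X K (1 : Fin (1 + 2 + 1))).pow j)
  rw [mem_homogeneousSubmodule]
  convert h using 1
  simp [smul_eq_mul]; omega

/-- (M2a) `c x₀ⁱ x₁ʲ / (x₀x₁)ᵐ = (c (x₁/x₀)^{j-m})|` when `j ≥ m`. -/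
theorem monFrac_eq_res₀ (c : K) (i j m : ℕ) (hij : i + j = 2 * m) (hjm : m ≤ j) :
    HomogeneousLocalization.Away.mk 𝒜 (X01_mem K) m (C c * X 0 ^ i * X 1 ^ j) (C_mul_X_pow_mul_X_pow_mem K c i j m hij) =
      res₀ (HomogeneousLocalization.Away.mk 𝒜 (ProjectiveSpace.X_mem (R := K) 0) (j - m) (C c * X 1 ^ (j - m))
        (C_mul_X_pow_mem K c 1 (j - m))) := by
  rw [awayMap_mk]
  apply HomogeneousLocalization.val_injective
  simp only [HomogeneousLocalization.Away.val_mk]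
  rw [Localization.mk_eq_mk_iff]
  refine Localization.r_of_eq ?_
  simp only [mul_pow]
  obtain ⟨e, rfl⟩ := Nat.exists_eq_add_of_le hjm
  obtain rfl : m = i + e := by omega
  simp only [Nat.add_sub_cancel_left]
  ring

/-- (M2b) `c x₀ⁱ x₁ʲ / (x₀x₁)ᵐ = t · (c (x₀/x₁)^{i-m+1})|` when `j < m`. -/
theorem monFrac_eq_tEl_mul_res₁ (c : K) (i j m : ℕ) (hij : i + j = 2 * m) (hjm : j < m) :
    HomogeneousLocalization.Away.mk 𝒜 (X01_mem K) m (C c * X 0 ^ i * X 1 ^ j) (C_mul_X_pow_mul_X_pow_mem K c i j m hij) =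
      tEl * res₁ (HomogeneousLocalization.Away.mk 𝒜 (ProjectiveSpace.X_mem (R := K) 1) (i - m + 1) (C c * X 0 ^ (i - m + 1))
        (C_mul_X_pow_mem K c 0 (i - m + 1))) := by
  rw [awayMap_mk, Literature.AlgebraicGeometry.Resolution.Away.mk_mul_mk]
  apply HomogeneousLocalization.val_injective
  simp only [HomogeneousLocalization.Away.val_mk]
  rw [Localization.mk_eq_mk_iff]
  refine Localization.r_of_eq ?_
  simp only [mul_pow]
  have hj : j = 2 * m - i := by omega
  subst hj
  obtain ⟨e, rfl⟩ := Nat.exists_eq_add_of_le (show m + 1 ≤ i by omega)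
  simp only [show m + 1 + e - m + 1 = e + 2 by omega, show 2 * m - (m + 1 + e) = m - 1 - e by omega]
  obtain ⟨m', rfl⟩ := Nat.exists_eq_add_of_le (show e + 1 ≤ m by omega)
  simp only [show e + 1 + m' - 1 - e = m' by omega]
  ring

section Kill

variable (fk : MvPolynomial.homogeneousSubmodule (Fin (1 + 2 + 1)) K →+*ᵍ MvPolynomial.homogeneousSubmodule (Fin (1 + 1)) K)
  (hfkX : ∀ i : Fin (1 + 2 + 1), fk (X i) = if h : (i : ℕ) < 1 + 1 then X ⟨i, h⟩ else 0)

include hfkX in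
/-- (M1) The kill map annihilates every monomial involving `x₂` or `x₃`. -/
theorem kill_monomial_eq_zero (α : Fin (1 + 2 + 1) →₀ ℕ) (c : K) (h : α 2 ≠ 0 ∨ α 3 ≠ 0) :
    fk (monomial α c) = 0 := by
  rw [monomial_eq, map_mul, Finsupp.prod, map_prod]
  rcases h with h | h
  · rw [Finset.prod_eq_zero (Finsupp.mem_support_iff.mpr h) (by rw [map_pow, hfkX, dif_neg (by decide), zero_pow h]), mul_zero]
  · rw [Finset.prod_eq_zero (Finsupp.mem_support_iff.mpr h) (by rw [map_pow, hfkX, dif_neg (by decide), zero_pow h]), mul_zero]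

/-- A finitely supported function on `Fin 4` vanishing at `2, 3` is `single 0 (α 0) + single 1 (α 1)`. -/
theorem finsupp_eq_single_add_single (α : Fin (1 + 2 + 1) →₀ ℕ) (h2 : α 2 = 0) (h3 : α 3 = 0) :
    α = Finsupp.single 0 (α 0) + Finsupp.single 1 (α 1) := by
  ext i
  fin_cases i <;> simp [h2, h3]

/-- The degree bookkeeping: a monomial of degree `2m` supported on `{x₀, x₁}` has `α 0 + α 1 = 2m`. -/
theorem deg_eq_of_mem {m : ℕ} {α : Fin (1 + 2 + 1) →₀ ℕ} {c : K} (hc : c ≠ 0) (hmem : (monomial α c : A4) ∈ 𝒜 (m • 2))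
    (h2 : α 2 = 0) (h3 : α 3 = 0) : α 0 + α 1 = 2 * m := by
  rw [mem_homogeneousSubmodule] at hmem
  have h := hmem (d := α) (by rwa [coeff_monomial, if_pos rfl])
  have hdeg : (Finsupp.degree : (Fin (1 + 2 + 1) →₀ ℕ) →+ ℕ) α = α 0 + α 1 := by
    conv_lhs => rw [finsupp_eq_single_add_single α h2 h3]
    rw [map_add, Finsupp.degree_single, Finsupp.degree_single]
  have h1 : (Finsupp.weight (1 : Fin (1 + 2 + 1) → ℕ)) α = (Finsupp.degree : (Fin (1 + 2 + 1) →₀ ℕ) →+ ℕ) α := by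
    rw [Finsupp.degree_eq_weight_one]; rfl
  rw [h1, hdeg, smul_eq_mul] at h
  omega

/-- A monomial supported on `{x₀, x₁}` is `C c · x₀ⁱ x₁ʲ`. -/
theorem monomial_eq_C_mul_X_pow (α : Fin (1 + 2 + 1) →₀ ℕ) (c : K) (h2 : α 2 = 0) (h3 : α 3 = 0) :
    (monomial α c : A4) = C c * X 0 ^ (α 0) * X 1 ^ (α 1) := by
  conv_lhs => rw [finsupp_eq_single_add_single α h2 h3]
  rw [show c = c * 1 from (mul_one c).symm, ← monomial_mul, ← C_mul_X_pow_eq_monomial, ← C_mul_X_pow_eq_monomial, mul_one,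
    map_one, one_mul]

/-- The splitting predicate is preserved by `0`. -/
theorem good_zero : ∃ (a : Away 𝒜 (X 0 : A4)) (b : Away 𝒜 (X 1 : A4)),
    (0 : Away 𝒜 (X 0 * X 1 : A4)) - (res₀ a + tEl * res₁ b) ∈ awayIdeal 𝒜 (X01_mem K) (kerKill[fk]) := ⟨0, 0, by simp⟩

/-- The splitting predicate is additive. -/
theorem good_add {z z' : Away 𝒜 (X 0 * X 1 : A4)}
    (hz : ∃ (a : Away 𝒜 (X 0 : A4)) (b : Away 𝒜 (X 1 : A4)), z - (res₀ a + tEl * res₁ b) ∈ awayIdeal 𝒜 (X01_mem K) (kerKill[fk]))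
    (hz' : ∃ (a : Away 𝒜 (X 0 : A4)) (b : Away 𝒜 (X 1 : A4)), z' - (res₀ a + tEl * res₁ b) ∈ awayIdeal 𝒜 (X01_mem K) (kerKill[fk])) :
    ∃ (a : Away 𝒜 (X 0 : A4)) (b : Away 𝒜 (X 1 : A4)), (z + z') - (res₀ a + tEl * res₁ b) ∈ awayIdeal 𝒜 (X01_mem K) (kerKill[fk]) := by
  obtain ⟨a, b, h⟩ := hz
  obtain ⟨a', b', h'⟩ := hz'
  refine ⟨a + a', b + b', ?_⟩
  have := Ideal.add_mem _ h h'
  convert this using 1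
  simp only [map_add]
  ring


include hfkX in
/-- ★ **THE TWISTED SPLITTING in `(K[x]_{x₀x₁})₀` modulo `(x₂, x₃)`**: every degree-zero fraction `z` is `a| + (x₁/x₀)·b|` modulo
`(ker f_K)_{(x₀x₁)}`, with `a ∈ (K[x]_{x₀})₀`, `b ∈ (K[x]_{x₁})₀` (`Ȟ¹(ℙ¹, 𝒪(1)) = 0` monomial by monomial). -/
theorem exists_split (z : Away 𝒜 (X 0 * X 1 : A4)) :
    ∃ (a : Away 𝒜 (X 0 : A4)) (b : Away 𝒜 (X 1 : A4)), z - (res₀ a + tEl * res₁ b) ∈ awayIdeal 𝒜 (X01_mem K) (kerKill[fk]) := by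
  classical
  obtain ⟨m, p, hp, rfl⟩ := HomogeneousLocalization.Away.mk_surjective 𝒜 (X01_mem K) z
  rw [awayMk_eq_sum_monomial]
  refine Finset.sum_induction _
    (fun z => ∃ (a : Away 𝒜 (X 0 : A4)) (b : Away 𝒜 (X 1 : A4)), z - (res₀ a + tEl * res₁ b) ∈ awayIdeal 𝒜 (X01_mem K) (kerKill[fk]))
    (fun _ _ => good_add K fk) (good_zero K fk) ?_
  rintro ⟨α, hα⟩ -
  by_cases h : α 2 ≠ 0 ∨ α 3 ≠ 0
  · exact ⟨0, 0, by simpa using mk_mem_awayIdeal 𝒜 (X01_mem K) _ (RingHom.mem_ker.mpr (kill_monomial_eq_zero K fk hfkX α _ h))⟩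
  · push Not at h
    obtain ⟨h2, h3⟩ := h
    have hc : coeff α p ≠ 0 := mem_support_iff.mp hα
    have hdeg := deg_eq_of_mem K hc (monomial_coeff_mem K hp α hα) h2 h3
    have heq : HomogeneousLocalization.Away.mk 𝒜 (X01_mem K) m (monomial α (coeff α p)) (monomial_coeff_mem K hp α hα) =
        HomogeneousLocalization.Away.mk 𝒜 (X01_mem K) m (C (coeff α p) * X 0 ^ (α 0) * X 1 ^ (α 1))
          (C_mul_X_pow_mul_X_pow_mem K (coeff α p) (α 0) (α 1) m hdeg) := by
      simp only [monomial_eq_C_mul_X_pow K α (coeff α p) h2 h3]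
    change ∃ a b, HomogeneousLocalization.Away.mk 𝒜 (X01_mem K) m (monomial α (coeff α p)) (monomial_coeff_mem K hp α hα) - _ ∈ _
    rw [heq]
    by_cases hjm : m ≤ α 1
    · rw [monFrac_eq_res₀ K _ _ _ _ hdeg hjm]
      exact ⟨HomogeneousLocalization.Away.mk 𝒜 (ProjectiveSpace.X_mem (R := K) 0) (α 1 - m) (C (coeff α p) * X 1 ^ (α 1 - m))
        (C_mul_X_pow_mem K _ 1 _), 0, by simp⟩
    · rw [monFrac_eq_tEl_mul_res₁ K _ _ _ _ hdeg (lt_of_not_ge hjm)]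
      exact ⟨0, HomogeneousLocalization.Away.mk 𝒜 (ProjectiveSpace.X_mem (R := K) 1) (α 0 - m + 1) (C (coeff α p) * X 0 ^ (α 0 - m + 1))
        (C_mul_X_pow_mem K _ 0 _), by simp⟩

end Kill

end P3Line

end Summit.ResolutionOfSingularities.ResolutionOfSingularities.Cruxes.EquisingularLiftNat.Sections

end
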